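import Summits.QuantumFields.QCD.Theorems.SpectralDefectExtinctionWindowExtinctionChessboardDeepAsymptotics

/-!
# Kato line, S3 audit fragment: the PINS class is inhabited

Line `kato-radius-collective-defects` of crux `SpectralDefectExtinction.WindowExtinction`
(item stmt-QuantumFields-8964).  Stub S3 (`stub_pinnedTightEdge`) asks for regularisation data that is
mass-scaling, asymptotically scaling and PINNED:

* volume cap `a_k (2L_k + 1) ≤ β_k²` eventually, and
* level pin `cE ≤ −m_crit(k) β_k ≤ CE` eventually, `0 < cE ≤ CE`,

together with BOTTOM and TIGHT (open).  This file records the cheap, purely book-keeping half: the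
data class is NON-EMPTY, and in fact EVERY asymptotically scaling triple `(a_k, β_k, Z_m(k))` with
`N_f ≤ 16` carries pinned data — keep `a, β, Z_m`, take the volume `L_k := ⌊β_k² / (4a_k)⌋₊`
(`a_k L_k ≥ β_k²/4 − a_k → ∞` because `β_k → ∞`, `deep_tendsto_beta_atTop`; and
`a_k(2L_k+1) ≤ β_k²/2 + a_k ≤ β_k²` eventually) and the level `m_crit(k) := −1/β_k`
(`−m_crit(k) β_k = 1` as soon as `β_k > 0`).  So the volume cap of PINS is compatible with the
structure field `tendsto_L : a_k L_k → ∞` of `QCDRegularisation`, and S3 is not vacuous / not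
refutable on book-keeping grounds: its content is BOTTOM ∧ TIGHT.
-/

noncomputable section

namespace Summit.QuantumFields.QCD.Cruxes.WindowExtinction.KatoRadiusCollectiveDefects

open scoped Topology
open Filter
open Literature.MathematicalPhysics.QuantumFieldTheory
open Summit.QuantumFields.QCD.Cruxes.WindowExtinction.ChessboardColdCells (deep_tendsto_beta_atTop)

variable {Nf : ℕ}

/-- The capped volume `⌊β²/(4a)⌋₊` is large: `β²/4 − a ≤ a ⌊β²/(4a)⌋₊` for `a > 0`. -/
theorem sq_div_four_sub_le_mul_floor {a β : ℝ} (ha : 0 < a) :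
    β ^ 2 / 4 - a ≤ a * (⌊β ^ 2 / (4 * a)⌋₊ : ℝ) := by
  have h := Nat.sub_one_lt_floor (β ^ 2 / (4 * a))
  have h' : a * (β ^ 2 / (4 * a) - 1) ≤ a * (⌊β ^ 2 / (4 * a)⌋₊ : ℝ) :=
    mul_le_mul_of_nonneg_left h.le ha.le
  have hid : a * (β ^ 2 / (4 * a) - 1) = β ^ 2 / 4 - a := by
    field_simp
  linarith [hid ▸ h']

/-- The capped volume `⌊β²/(4a)⌋₊` obeys the cap: `a (2⌊β²/(4a)⌋₊ + 1) ≤ β²/2 + a` for `a > 0`. -/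
theorem mul_two_floor_add_one_le {a β : ℝ} (ha : 0 < a) :
    a * (2 * (⌊β ^ 2 / (4 * a)⌋₊ : ℝ) + 1) ≤ β ^ 2 / 2 + a := by
  have hx : (⌊β ^ 2 / (4 * a)⌋₊ : ℝ) ≤ β ^ 2 / (4 * a) := Nat.floor_le (by positivity)
  calc a * (2 * (⌊β ^ 2 / (4 * a)⌋₊ : ℝ) + 1) ≤ a * (2 * (β ^ 2 / (4 * a)) + 1) := by gcongr
    _ = β ^ 2 / 2 + a := by field_simp; ring

/-- `a_k ⌊β_k²/(4a_k)⌋₊ → ∞` along any asymptotically scaling data with `N_f ≤ 16`. -/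
theorem tendsto_a_mul_floor_atTop (hNf : Nf ≤ 16) (reg₀ : QCDRegularisation Nf)
    (hAS : (reg₀.scheme 0 0 0).HasAsymptoticScaling) :
    Tendsto (fun k => reg₀.a k * ((fun k => ⌊reg₀.β k ^ 2 / (4 * reg₀.a k)⌋₊) k : ℝ)) atTop atTop := by
  have hβ : Tendsto reg₀.β atTop atTop := deep_tendsto_beta_atTop hNf (reg₀.scheme 0 0 0) hAS
  have h1 : Tendsto (fun k => reg₀.β k ^ 2 / 4) atTop atTop :=
    ((tendsto_pow_atTop two_ne_zero).comp hβ).atTop_div_const (by norm_num)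
  have h2 : Tendsto (fun k => reg₀.β k ^ 2 / 4 + -reg₀.a k) atTop atTop :=
    h1.atTop_add reg₀.tendsto_a.neg
  refine tendsto_atTop_mono (fun k => ?_) h2
  have := sq_div_four_sub_le_mul_floor (β := reg₀.β k) (reg₀.a_pos k)
  simpa [sub_eq_add_neg] using this

/-- The volume cap holds eventually for `L_k := ⌊β_k²/(4a_k)⌋₊`. -/
theorem eventually_volumeCap_floor (hNf : Nf ≤ 16) (reg₀ : QCDRegularisation Nf)
    (hAS : (reg₀.scheme 0 0 0).HasAsymptoticScaling) :
    ∀ᶠ k : ℕ in atTop,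
      reg₀.a k * (2 * ((⌊reg₀.β k ^ 2 / (4 * reg₀.a k)⌋₊ : ℕ) : ℝ) + 1) ≤ reg₀.β k ^ 2 := by
  have hβ : Tendsto reg₀.β atTop atTop := deep_tendsto_beta_atTop hNf (reg₀.scheme 0 0 0) hAS
  have h1 : ∀ᶠ k : ℕ in atTop, 1 ≤ reg₀.β k := hβ.eventually_ge_atTop 1
  have h2 : ∀ᶠ k : ℕ in atTop, reg₀.a k ≤ 1 / 2 :=
    reg₀.tendsto_a.eventually (eventually_le_nhds (by norm_num : (0 : ℝ) < 1 / 2))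
  filter_upwards [h1, h2] with k hk1 hk2
  have h3 := mul_two_floor_add_one_le (β := reg₀.β k) (reg₀.a_pos k)
  nlinarith [h3, hk1, hk2]

/-- **Every asymptotically scaling triple `(a, β, Z_m)` carries PINNED data** (`N_f ≤ 16`): keeping
`a, β, Z_m` (hence both scaling laws), the volume `⌊β_k²/(4a_k)⌋₊` and the level `−1/β_k` satisfy the two
pins of S2a/S2b/S3 with `cE = CE = 1`, and the level is eventually negative (supercritical side). -/
theorem exists_pinned_of_scaling (hNf : Nf ≤ 16) (reg₀ : QCDRegularisation Nf)
    (hMS : reg₀.HasMassScaling) (hAS : (reg₀.scheme 0 0 0).HasAsymptoticScaling) :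
    ∃ reg : QCDRegularisation Nf, reg.a = reg₀.a ∧ reg.β = reg₀.β ∧ reg.Zm = reg₀.Zm ∧
      reg.HasMassScaling ∧ (reg.scheme 0 0 0).HasAsymptoticScaling ∧
      ((∀ᶠ k : ℕ in Filter.atTop, reg.a k * (2 * (reg.L k : ℝ) + 1) ≤ reg.β k ^ 2) ∧
          (∃ cE CE : ℝ, 0 < cE ∧ cE ≤ CE ∧ ∀ᶠ k : ℕ in Filter.atTop,
            cE ≤ -reg.mcrit k * reg.β k ∧ -reg.mcrit k * reg.β k ≤ CE)) ∧
      (∀ᶠ k : ℕ in Filter.atTop, reg.mcrit k < 0) := by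
  have hβ : Tendsto reg₀.β atTop atTop := deep_tendsto_beta_atTop hNf (reg₀.scheme 0 0 0) hAS
  refine ⟨{ reg₀ with
      L := fun k => ⌊reg₀.β k ^ 2 / (4 * reg₀.a k)⌋₊
      tendsto_L := tendsto_a_mul_floor_atTop hNf reg₀ hAS
      mcrit := fun k => -1 / reg₀.β k }, rfl, rfl, rfl, hMS, hAS,
    ⟨eventually_volumeCap_floor hNf reg₀ hAS, 1, 1, one_pos, le_rfl, ?_⟩, ?_⟩
  · filter_upwards [hβ.eventually_ge_atTop 1] with k hk
    have hβ0 : reg₀.β k ≠ 0 := by positivity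
    have : -(-1 / reg₀.β k) * reg₀.β k = 1 := by field_simp
    simp only [this, le_refl, and_self]
  · filter_upwards [hβ.eventually_ge_atTop 1] with k hk
    have : 0 < reg₀.β k := by positivity
    show -1 / reg₀.β k < 0
    exact div_neg_of_neg_of_pos (by norm_num) this

/-- **S3's data class is inhabited for `N_f ∈ {2, 3}`**: there are mass-scaling, asymptotically scaling,
PINNED regularisation data (volume cap `a_k(2L_k+1) ≤ β_k²` and level pin `cE ≤ −m_crit(k)β_k ≤ CE`
eventually).  The open content of `stub_pinnedTightEdge` is therefore exactly BOTTOM ∧ TIGHT. -/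
theorem kato_pins_inhabited :
    ∀ (Nf : ℕ), (Nf = 2 ∨ Nf = 3) → ∃ (reg : QCDRegularisation Nf),
      reg.HasMassScaling ∧ (reg.scheme 0 0 0).HasAsymptoticScaling ∧
      ((∀ᶠ k : ℕ in Filter.atTop, reg.a k * (2 * (reg.L k : ℝ) + 1) ≤ reg.β k ^ 2) ∧
          (∃ cE CE : ℝ, 0 < cE ∧ cE ≤ CE ∧ ∀ᶠ k : ℕ in Filter.atTop,
            cE ≤ -reg.mcrit k * reg.β k ∧ -reg.mcrit k * reg.β k ≤ CE)) ∧
      (∀ᶠ k : ℕ in Filter.atTop, reg.mcrit k < 0) := by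
  intro Nf hNf
  have hNf16 : Nf ≤ 16 := by rcases hNf with rfl | rfl <;> norm_num
  obtain ⟨reg, -, -, -, hMS, hAS, hpins, hneg⟩ :=
    exists_pinned_of_scaling hNf16 (QCDRegularisation.canonicalAF Nf)
      QCDRegularisation.canonicalAF_hasMassScaling QCDScheme.zeroAF_hasAsymptoticScaling
  exact ⟨reg, hMS, hAS, hpins, hneg⟩

end Summit.QuantumFields.QCD.Cruxes.WindowExtinction.KatoRadiusCollectiveDefects

end
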